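import Summits.AtomisticToContinuum.Crystallization.Theorems.FluxTubeKeplerFloorGivesLayered
import Summits.AtomisticToContinuum.Crystallization.Theorems.FluxTubeKeplerFluxCellKeplerSingleScale
import Summits.AtomisticToContinuum.Crystallization.Theorems.ChessboardParticlePlanesPeriodicWindowsIffCrystallization

/-!
# `HardCoreRung` — F4 on-path certificate (no `sorry`): `Crystallization → HardCoreRung`

Forward rung over `FluxTubeKepler.FloorGivesLayered` (crux dir `FluxCellKepler`, stmt-AtomisticToContinuum-15221;
fwd-rung G1 gen 11).  Re-declares the family of `Lines/HardCoreRung.lean` in namespace `…HardCoreLadder.OnPath` and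
proves that the sub-problem implies every member of the dial (`sepRung_of_crystallization`, via the landed
`ChessboardParticlePlanesPeriodicWindowsIffCrystallization.periodicWindows_of_crystallization`), in particular the
deciding rung (`HardCoreRung_of_Crystallization`, `@[aesop safe apply]`).  The rung is a consequence of the
sub-problem and that is fine because F3 pins the other end of the dial to the proved floor
(`Lines/HardCoreRung_special.lean: sepRung_zero`, `sepRung_seven_tenths`) — the [nec]-trap guard is discharged by
the witness.
-/

noncomputable section

namespace Summit.AtomisticToContinuum.Crystallization.Cruxes.FluxCellKepler.HardCoreLadder.OnPath

open Filter Topology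
open Literature.MathematicalPhysics.StatisticalMechanics
open Summit.AtomisticToContinuum.Crystallization.Theorems.FluxCellKeplerSingleScale (LayeredGood)

local notation "E3" => EuclideanSpace ℝ (Fin 3)

/-- FLOOR(P₀) (verbatim). -/
def Floor (P₀ : PeriodicConfiguration 3) : Prop :=
  ∀ (N : ℕ) (x : Fin N → E3), IsGroundState lennardJones x →
    (N : ℝ) * P₀.energyPerParticle lennardJones ≤ interactionEnergy lennardJones x

/-- HARD-CORE BUDGET with core `δ₀` (verbatim). -/
def SepBudget (δ₀ : ℝ) (P₀ : PeriodicConfiguration 3) : Prop :=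
  ∀ R η : ℝ, 0 < R → 0 < η → ∃ c : ℝ, 0 < c ∧
    ∀ (N : ℕ) (x : Fin N → E3), IsGroundState lennardJones x →
      (∀ i j : Fin N, i ≠ j → δ₀ ≤ dist (x i) (x j)) →
      c * (Nat.card {i : Fin N // ¬ LayeredGood R η x i} : ℝ) ≤
        interactionEnergy lennardJones x - (N : ℝ) * P₀.energyPerParticle lennardJones

/-- Periodic windows along the sequence (verbatim). -/
def HasPeriodicWindows (x : (N : ℕ) → (Fin N → E3)) : Prop :=
  ∃ P : PeriodicConfiguration 3, ∀ R ε : ℝ, 0 < ε → ∃ᶠ N in atTop, ∃ t : E3,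
    (∀ q ∈ P.points, ‖q‖ ≤ R → ∃ i : Fin N, dist (x N i + t) q ≤ ε) ∧
    (∀ i : Fin N, ‖x N i + t‖ ≤ R → ∃ q ∈ P.points, dist (x N i + t) q ≤ ε)

/-- The graded family (verbatim). -/
def SepRung (δ₀ : ℝ) : Prop :=
  ∀ P₀ : PeriodicConfiguration 3, Floor P₀ → SepBudget δ₀ P₀ →
    ∀ x : (N : ℕ) → (Fin N → E3), (∀ N, IsGroundState lennardJones (x N)) → HasPeriodicWindows x

/-- The deciding rung (verbatim). -/
def HardCoreRung : Prop := SepRung (3 / 4)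

/-- ON-PATH: `Crystallization → SepRung δ₀` for every core. -/
theorem sepRung_of_crystallization (δ₀ : ℝ) (h : _root_.Crystallization) : SepRung δ₀ :=
  fun _ _ _ x hx =>
    Theorems.ChessboardParticlePlanesPeriodicWindowsIffCrystallization.periodicWindows_of_crystallization h x hx

/-- ON-PATH for the deciding rung. -/
@[aesop safe apply]
theorem HardCoreRung_of_Crystallization (h : _root_.Crystallization) : HardCoreRung :=
  sepRung_of_crystallization _ h

/-- The on-path lemma in `example` form. -/
example : _root_.Crystallization → HardCoreRung := HardCoreRung_of_Crystallization

end Summit.AtomisticToContinuum.Crystallization.Cruxes.FluxCellKepler.HardCoreLadder.OnPath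

end
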